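import Summits.Ventures.CertifiedManyBodySolver.Theorems.TcThermcert1SaddleTorusPhase
import Mathlib
import HarnessLib

/-!
# Saddle geometry on the fugacity torus, part 8: the global gap off the local box (clause (iii))

Helper file for route `TcThermcert1`, crux `ThermalStiffnessCeilingU8b10_le_1o8` (item `stmt-Ventures-26381`), line
`Cruxes/ThermalStiffnessCeilingU8b10_le_1o8/Lines/zerofree_corridor.lean` v8, registered stub `stub_saddleGeometry` (K3b); step S8 of
`Cruxes/ThermalStiffnessCeilingU8b10_le_1o8/STUB-PLAN-stub_saddleGeometry.md`.

In polar form `z₀ = r₁e^{iφ₀}`, `w₀ = r₂e^{iψ₀}` the real part of the exponent increment along the torus is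
`Re G(u,v) = [log‖1+r₁e^{i(φ₀+u)}‖ − log‖1+r₁e^{iφ₀}‖] + [log‖1+r₂e^{i(ψ₀+v)}‖ − log‖1+r₂e^{iψ₀}‖] + Re[h(…) − h(…)]`
(the linear term `−i(αu+βv)` is purely imaginary).  Using the angular profile of part 2
(`log_norm_one_add_circle_sub_le/ge`):

* `exists_reduced_angle`, `log_norm_one_add_circle_far`: the profile bound for unreduced angles `ρ' ≤ |θ| ≤ 2π − ρ'`
  (shift by `±2π` into `[−π, π]`);
* `profile_constants`: for `r ∈ [13/18, 15/18]`, `2r/(π²(1+r)²) ≥ 1/25` (`π < 3.15`) and `r/(2(1−r)²) ≤ 15`;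
* `log_norm_circle_diff_le_near/far`: per coordinate, `≤ 15φ₀²` always and `≤ −ρ'²/25 + 15φ₀²` in the far case;
* `re_h_diff_le`: `Re[h(p) − h(q)] ≤ 2ε` on the torus (both circles lie in the annulus);
* `saddle_global_bound` (**clause (iii)**): if `|φ₀|, |ψ₀| ≤ ρ/2`, `ρ ≤ π`, `|u|, |v| ≤ π` and `|u| ≥ ρ ∨ |v| ≥ ρ` then
  `Re G ≤ −ρ²/100 + 15(φ₀² + ψ₀²) + 2ε` — so the K3b prover may take `γ = ρ²/200` once `|φ₀|, |ψ₀| ≤ 250ε` and `ε ≤ ρ²/1000`,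
  `ρ ≤ 10⁻⁶`.

[folklore] No definitions; no `sorry`.
-/

noncomputable section

open Complex Metric Set

namespace Summit.Ventures.CertifiedManyBodySolver.Theorems.TcThermcert1.ZeroFreeCorridor

/-! ## §9 Clause (iii): the global gap off the local box -/

/-- `‖1 + r e^{iθ}‖ ≤ 1 + r`, in logarithms. -/
theorem log_norm_one_add_circle_le {r : ℝ} (hr : 0 ≤ r) (hr' : r < 1) (θ : ℝ) :
    Real.log ‖1 + (r : ℂ) * cexp ((θ : ℂ) * I)‖ ≤ Real.log (1 + r) := by
  have hN0 : 0 < ‖1 + (r : ℂ) * cexp ((θ : ℂ) * I)‖ := norm_pos_iff.mpr (one_add_circle_ne_zero hr hr' θ)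
  apply Real.log_le_log hN0
  calc ‖1 + (r : ℂ) * cexp ((θ : ℂ) * I)‖ ≤ ‖(1 : ℂ)‖ + ‖(r : ℂ) * cexp ((θ : ℂ) * I)‖ := norm_add_le _ _
    _ = 1 + r := by
      rw [norm_one, norm_mul, Complex.norm_real, Complex.norm_exp_ofReal_mul_I, mul_one, Real.norm_eq_abs,
        abs_of_nonneg hr]

/-- `e^{iθ}` is `2π`-periodic in the real angle. -/
theorem cexp_angle_sub_two_pi (θ : ℝ) : cexp (((θ - 2 * Real.pi : ℝ) : ℂ) * I) = cexp ((θ : ℂ) * I) := by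
  rw [Complex.ofReal_sub, sub_mul, Complex.exp_sub, show ((2 * Real.pi : ℝ) : ℂ) * I = 2 * Real.pi * I by push_cast; ring,
    Complex.exp_two_pi_mul_I, div_one]

/-- `e^{iθ}` is `2π`-periodic in the real angle (shift up). -/
theorem cexp_angle_add_two_pi (θ : ℝ) : cexp (((θ + 2 * Real.pi : ℝ) : ℂ) * I) = cexp ((θ : ℂ) * I) := by
  rw [Complex.ofReal_add, add_mul, Complex.exp_add, show ((2 * Real.pi : ℝ) : ℂ) * I = 2 * Real.pi * I by push_cast; ring,
    Complex.exp_two_pi_mul_I, mul_one]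

/-- Angle reduction: every real angle at distance `≥ ρ'` from `2πℤ ∩ [−2π, 2π]` has a representative in `[−π, π]` of modulus
`≥ ρ'`, with the same point on the circle. -/
theorem exists_reduced_angle {θ ρ' : ℝ} (h1 : ρ' ≤ |θ|) (h2 : |θ| ≤ 2 * Real.pi - ρ') (h3 : 0 ≤ ρ') :
    ∃ θ' : ℝ, |θ'| ≤ Real.pi ∧ ρ' ≤ |θ'| ∧ cexp ((θ : ℂ) * I) = cexp ((θ' : ℂ) * I) := by
  by_cases hθ : |θ| ≤ Real.pi
  · exact ⟨θ, hθ, h1, rfl⟩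
  rcases le_or_gt 0 θ with h0 | h0
  · rw [abs_of_nonneg h0] at hθ h1 h2
    refine ⟨θ - 2 * Real.pi, ?_, ?_, (cexp_angle_sub_two_pi θ).symm⟩
    · rw [abs_le]; constructor <;> linarith
    · rw [abs_of_nonpos (by linarith)]; linarith
  · rw [abs_of_neg h0] at hθ h1 h2
    refine ⟨θ + 2 * Real.pi, ?_, ?_, (cexp_angle_add_two_pi θ).symm⟩
    · rw [abs_le]; constructor <;> linarith
    · rw [abs_of_nonneg (by linarith)]; linarith

/-- The angular profile bound of part 2, for unreduced angles: if `ρ' ≤ |θ| ≤ 2π − ρ'` then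
`log ‖1 + r e^{iθ}‖ − log (1+r) ≤ −(2r/(π²(1+r)²)) ρ'²`. -/
theorem log_norm_one_add_circle_far {r θ ρ' : ℝ} (hr : 0 < r) (hr' : r < 1) (h1 : ρ' ≤ |θ|)
    (h2 : |θ| ≤ 2 * Real.pi - ρ') (h3 : 0 ≤ ρ') :
    Real.log ‖1 + (r : ℂ) * cexp ((θ : ℂ) * I)‖ - Real.log (1 + r) ≤ -(2 * r / (Real.pi ^ 2 * (1 + r) ^ 2)) * ρ' ^ 2 := by
  obtain ⟨θ', hθ', hρθ', he⟩ := exists_reduced_angle h1 h2 h3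
  rw [he]
  refine (log_norm_one_add_circle_sub_le hr hr' hθ').trans ?_
  have hc : 0 ≤ 2 * r / (Real.pi ^ 2 * (1 + r) ^ 2) := by positivity
  have hsq : ρ' ^ 2 ≤ θ' ^ 2 := by rw [← sq_abs θ']; exact pow_le_pow_left₀ h3 hρθ' 2
  have := mul_le_mul_of_nonneg_left hsq hc
  linarith

/-- The two numerical constants for radii in `[13/18, 15/18]`: the curvature of the profile is `≥ 1/25` and the base-point
correction coefficient is `≤ 15`. -/
theorem profile_constants {r : ℝ} (hr : 13 / 18 ≤ r) (hr' : r ≤ 15 / 18) :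
    1 / 25 ≤ 2 * r / (Real.pi ^ 2 * (1 + r) ^ 2) ∧ r / (2 * (1 - r) ^ 2) ≤ 15 := by
  have hpi := Real.pi_lt_d2
  have hpi0 := Real.pi_pos
  constructor
  · rw [div_le_div_iff₀ (by norm_num) (by positivity)]
    have h1 : Real.pi ^ 2 ≤ 3.15 ^ 2 := by
      exact pow_le_pow_left₀ hpi0.le hpi.le 2
    have h2 : (1 + r) ^ 2 ≤ (33 / 18) ^ 2 := pow_le_pow_left₀ (by linarith) (by linarith) 2
    have := mul_le_mul h1 h2 (by positivity) (by positivity)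
    nlinarith
  · rw [div_le_iff₀ (by nlinarith)]
    nlinarith

/-- Per-coordinate bound, near case: `log ‖1 + r e^{iθ}‖ − log ‖1 + r e^{iφ₀}‖ ≤ 15 φ₀²` for any angle `θ`. -/
theorem log_norm_circle_diff_le_near {r : ℝ} (hr : 13 / 18 ≤ r) (hr' : r ≤ 15 / 18) (θ φ₀ : ℝ) :
    Real.log ‖1 + (r : ℂ) * cexp ((θ : ℂ) * I)‖ - Real.log ‖1 + (r : ℂ) * cexp ((φ₀ : ℂ) * I)‖ ≤ 15 * φ₀ ^ 2 := by
  have hr0 : 0 < r := by linarith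
  have hr1 : r < 1 := by linarith
  have h1 := log_norm_one_add_circle_le hr0.le hr1 θ
  have h2 := log_norm_one_add_circle_sub_ge hr0 hr1 φ₀
  have h3 := mul_le_mul_of_nonneg_right (profile_constants hr hr').2 (sq_nonneg φ₀)
  linarith

/-- Per-coordinate bound, far case: if `ρ' ≤ |θ| ≤ 2π − ρ'` then
`log ‖1 + r e^{iθ}‖ − log ‖1 + r e^{iφ₀}‖ ≤ −ρ'²/25 + 15 φ₀²`. -/
theorem log_norm_circle_diff_le_far {r θ ρ' : ℝ} (hr : 13 / 18 ≤ r) (hr' : r ≤ 15 / 18) (h1 : ρ' ≤ |θ|)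
    (h2 : |θ| ≤ 2 * Real.pi - ρ') (h3 : 0 ≤ ρ') (φ₀ : ℝ) :
    Real.log ‖1 + (r : ℂ) * cexp ((θ : ℂ) * I)‖ - Real.log ‖1 + (r : ℂ) * cexp ((φ₀ : ℂ) * I)‖ ≤
      -(ρ' ^ 2 / 25) + 15 * φ₀ ^ 2 := by
  have hr0 : 0 < r := by linarith
  have hr1 : r < 1 := by linarith
  have h4 := log_norm_one_add_circle_far hr0 hr1 h1 h2 h3
  have h5 := log_norm_one_add_circle_sub_ge hr0 hr1 φ₀
  have hc := profile_constants hr hr'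
  have h6 := mul_le_mul_of_nonneg_right hc.2 (sq_nonneg φ₀)
  have h7 := mul_le_mul_of_nonneg_right hc.1 (sq_nonneg ρ')
  linarith

/-- The torus circles of radii in `[13/18, 15/18]` lie in the annulus `2/3 < |ζ| < 8/9`. -/
theorem circle_mem_annulus {r : ℝ} (hr : 13 / 18 ≤ r) (hr' : r ≤ 15 / 18) (θ : ℝ) :
    (r : ℂ) * cexp ((θ : ℂ) * I) ∈ {ζ : ℂ | 2 / 3 < ‖ζ‖ ∧ ‖ζ‖ < 8 / 9} := by
  simp only [Set.mem_setOf_eq, norm_mul, Complex.norm_real, Complex.norm_exp_ofReal_mul_I, mul_one, Real.norm_eq_abs,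
    abs_of_nonneg (show (0 : ℝ) ≤ r by linarith)]
  constructor <;> linarith

/-- The increment of the perturbation along the torus has real part at most `2ε`. -/
theorem re_h_diff_le {h : ℂ × ℂ → ℂ} {ε : ℝ}
    (hB : ∀ p ∈ ({ζ : ℂ | 2 / 3 < ‖ζ‖ ∧ ‖ζ‖ < 8 / 9} ×ˢ {ζ : ℂ | 2 / 3 < ‖ζ‖ ∧ ‖ζ‖ < 8 / 9}), ‖h p‖ ≤ ε)
    {r₁ r₂ : ℝ} (hr₁ : 13 / 18 ≤ r₁) (hr₁' : r₁ ≤ 15 / 18) (hr₂ : 13 / 18 ≤ r₂) (hr₂' : r₂ ≤ 15 / 18) (θ₁ θ₂ φ₁ φ₂ : ℝ) :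
    (h ((r₁ : ℂ) * cexp ((θ₁ : ℂ) * I), (r₂ : ℂ) * cexp ((θ₂ : ℂ) * I)) -
        h ((r₁ : ℂ) * cexp ((φ₁ : ℂ) * I), (r₂ : ℂ) * cexp ((φ₂ : ℂ) * I))).re ≤ 2 * ε := by
  have ha := hB _ (Set.mk_mem_prod (circle_mem_annulus hr₁ hr₁' θ₁) (circle_mem_annulus hr₂ hr₂' θ₂))
  have hb := hB _ (Set.mk_mem_prod (circle_mem_annulus hr₁ hr₁' φ₁) (circle_mem_annulus hr₂ hr₂' φ₂))
  exact (Complex.re_le_norm _).trans ((norm_sub_le _ _).trans (by linarith))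

/-- **Clause (iii) of K3b, the global gap.**  On the torus of radii `r₁, r₂ ∈ [13/18, 15/18]` through a base point with angles
`|φ₀|, |ψ₀| ≤ ρ/2` (`ρ ≤ π`), the exponent increment
`G = [log(1+r₁e^{i(φ₀+u)}) − log(1+r₁e^{iφ₀})] + [log(1+r₂e^{i(ψ₀+v)}) − log(1+r₂e^{iψ₀})] + [h(…) − h(…)] − i(αu+βv)`
has `Re G ≤ −ρ²/100 + 15(φ₀² + ψ₀²) + 2ε` as soon as `|u| ≥ ρ` or `|v| ≥ ρ` (`|u|, |v| ≤ π`). -/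
theorem saddle_global_bound {h : ℂ × ℂ → ℂ} {ε : ℝ}
    (hB : ∀ p ∈ ({ζ : ℂ | 2 / 3 < ‖ζ‖ ∧ ‖ζ‖ < 8 / 9} ×ˢ {ζ : ℂ | 2 / 3 < ‖ζ‖ ∧ ‖ζ‖ < 8 / 9}), ‖h p‖ ≤ ε)
    {r₁ r₂ φ₀ ψ₀ ρ α β u v : ℝ} (hr₁ : 13 / 18 ≤ r₁) (hr₁' : r₁ ≤ 15 / 18) (hr₂ : 13 / 18 ≤ r₂) (hr₂' : r₂ ≤ 15 / 18)
    (hρπ : ρ ≤ Real.pi) (hφ₀ : |φ₀| ≤ ρ / 2) (hψ₀ : |ψ₀| ≤ ρ / 2) (hu : |u| ≤ Real.pi) (hv : |v| ≤ Real.pi)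
    (hfar : ρ ≤ |u| ∨ ρ ≤ |v|) (G : ℂ)
    (hG : G = Complex.log (1 + (r₁ : ℂ) * cexp (((φ₀ + u : ℝ) : ℂ) * I)) - Complex.log (1 + (r₁ : ℂ) * cexp ((φ₀ : ℂ) * I)) +
      (Complex.log (1 + (r₂ : ℂ) * cexp (((ψ₀ + v : ℝ) : ℂ) * I)) - Complex.log (1 + (r₂ : ℂ) * cexp ((ψ₀ : ℂ) * I))) +
      (h ((r₁ : ℂ) * cexp (((φ₀ + u : ℝ) : ℂ) * I), (r₂ : ℂ) * cexp (((ψ₀ + v : ℝ) : ℂ) * I)) -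
        h ((r₁ : ℂ) * cexp ((φ₀ : ℂ) * I), (r₂ : ℂ) * cexp ((ψ₀ : ℂ) * I))) -
      I * (α * u + β * v)) :
    G.re ≤ -(ρ ^ 2 / 100) + 15 * (φ₀ ^ 2 + ψ₀ ^ 2) + 2 * ε := by
  have hr₁0 : 0 < r₁ := by linarith
  have hr₂0 : 0 < r₂ := by linarith
  have hGre : G.re =
      (Real.log ‖1 + (r₁ : ℂ) * cexp (((φ₀ + u : ℝ) : ℂ) * I)‖ - Real.log ‖1 + (r₁ : ℂ) * cexp ((φ₀ : ℂ) * I)‖) +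
      (Real.log ‖1 + (r₂ : ℂ) * cexp (((ψ₀ + v : ℝ) : ℂ) * I)‖ - Real.log ‖1 + (r₂ : ℂ) * cexp ((ψ₀ : ℂ) * I)‖) +
      (h ((r₁ : ℂ) * cexp (((φ₀ + u : ℝ) : ℂ) * I), (r₂ : ℂ) * cexp (((ψ₀ + v : ℝ) : ℂ) * I)) -
        h ((r₁ : ℂ) * cexp ((φ₀ : ℂ) * I), (r₂ : ℂ) * cexp ((ψ₀ : ℂ) * I))).re := by
    have hI : (I * (α * u + β * v : ℂ)).re = 0 := by simp
    rw [hG, Complex.sub_re, hI, sub_zero, Complex.add_re, Complex.add_re, Complex.sub_re, Complex.sub_re, Complex.log_re,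
      Complex.log_re, Complex.log_re, Complex.log_re]
  have hH := re_h_diff_le hB hr₁ hr₁' hr₂ hr₂' (φ₀ + u) (ψ₀ + v) φ₀ ψ₀
  have hρ0 : 0 ≤ ρ := by linarith [abs_nonneg φ₀]
  -- the triangle inequalities for the shifted angles
  have htri : ∀ c w : ℝ, |c| ≤ ρ / 2 → |w| ≤ Real.pi → ρ ≤ |w| → ρ / 2 ≤ |c + w| ∧ |c + w| ≤ 2 * Real.pi - ρ / 2 := by
    intro c w hc hw hρw
    have h1 : |w| ≤ |c + w| + |c| := by
      have := abs_add_le (c + w) (-c); rwa [abs_neg, show c + w + -c = w by ring] at this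
    have h2 := abs_add_le c w
    constructor <;> linarith
  rw [hGre]
  rcases hfar with hfu | hfv
  · obtain ⟨h1, h2⟩ := htri φ₀ u hφ₀ hu hfu
    have hA := log_norm_circle_diff_le_far hr₁ hr₁' h1 h2 (by linarith) φ₀
    have hBv := log_norm_circle_diff_le_near hr₂ hr₂' (ψ₀ + v) ψ₀
    nlinarith [sq_nonneg ψ₀]
  · obtain ⟨h1, h2⟩ := htri ψ₀ v hψ₀ hv hfv
    have hA := log_norm_circle_diff_le_near hr₁ hr₁' (φ₀ + u) φ₀
    have hBv := log_norm_circle_diff_le_far hr₂ hr₂' h1 h2 (by linarith) ψ₀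
    nlinarith [sq_nonneg φ₀]

end Summit.Ventures.CertifiedManyBodySolver.Theorems.TcThermcert1.ZeroFreeCorridor

end
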